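import Literature.AnabelianGeometry.SemiGraphs.ArithThm54iiiUmbrellaOuterModel
import Literature.AnabelianGeometry.SemiGraphs.ArithBTempOuterModel
import Literature.AnabelianGeometry.SemiGraphs.ArithBTempCentraliserFree
import HarnessLib

/-!
# [SemiAnbd] Thm 5.4 (iii), compatible reading, at the outer models WITH THE CANONICAL `B^temp(φ)` —
# (iii) corollary v2: the datum `btemp` and its laws `hover`, `hbtempφ` bound to abc-iut-w4-d053's
# `outerSemidirectProductMap` (proof-only)

Mochizuki, *Semi-graphs of anabelioids*, Publ. RIMS **42** (2006) 221–322, §0 p. 5 (functoriality of `G ⋊^out J`),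
§5 Def 5.1 (i)/(iv) p. 62, Prop 5.2 (iv) p. 64, Thm 5.4 (iii) p. 66 ("Applying `B^temp(−)` …")
[cite: MochizukiSemiAnbd2006, Thm 5.4 (iii), p. 66].

PROOF-ONLY file (abc-iut cell, layer L3, sub-DAG `plan/L3/SUBDAG-SemiAnbd-Thm54.md`; row «T54·COROLLARY-INTEGRATOR»,
(iii) v2, seat abc-iut-w4-d089 gen 6).  No definition, no new named fact, no producer restated.  v1
(`arithQuasiGeometricCorrespondenceStatementCompat_outerModel`, ArithThm54iiiUmbrellaOuterModel.lean, p438883) keeps the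
arithmetic `B^temp` of the junction-v5 umbrella as a DATUM `btemp φ h₁ h₂ : Π^temp_𝔊 →* Π^temp_ℍ` with two laws:
`hover` (it covers `e : Π_A ≅ Π_{A′}`) and `hbtempφ` (it restricts on `ι_𝔾(π₁^temp 𝔾)` to `ι_ℍ ∘ φ̂_{φ_𝔾}` up to
`Ker(aug_ℍ)`-conjugacy).  abc-iut-w4-d053's `ArithBTempOuterModel.lean` (p439273) shows that at the outer models such a
homomorphism is CANONICAL: `outerSemidirectProductMap ρ_𝔾 ρ_ℍ e φ̂ hcompat hZ : π₁^temp(𝔾) ⋊^out Π_A → π₁^temp(ℍ′) ⋊^out Π_{A′}`,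
`(β, a) ↦ (β′, e a)` with `β′` THE automorphism in the class `ρ_ℍ(e a)` transporting `β` along `φ̂` — it EXISTS given
the compatibility of representatives `hcompat` (Prop 3.6 (iv) at `ρ(a)` along `φ̂`), is UNIQUE given a
centraliser-free image `hZ` (automatic for an open image in the temp-slim `π₁^temp(ℍ′)`,
`centraliserFree_of_isOpen_range`), covers `e` (`outerSemidirectProductSnd_outerSemidirectProductMap` = `hover`) and
restricts to `φ̂` ON THE NOSE (`outerSemidirectProductMap_toOuterSemidirectProduct` = `hbtempφ` with `δ = 1`).
Here v1 is instantiated at `btemp φ h₁ h₂ := outerSemidirectProductMap ρ_𝔾 ρ_ℍ e φ̂_{φ_𝔾} (hcompat φ …) (hZ φ …)`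
with `φ̂_{φ_𝔾} := φc φ.geom` the umbrella's chart-level representative of the dictionary arrow:

* `arithQuasiGeometricCorrespondenceStatementCompat_outerModel_canonicalBTemp` — v1's binder list with `btemp`,
  `hover`, `hbtempφ` REPLACED by the inputs `hZ`, `hcompat` of the canonical map (per locally open `φ` over `A`)
  and `hcont` now ABOUT the canonical map (its continuity for the chosen topologies — the one law
  abc-iut-w4-d053 leaves to the topology package); conclusion: the umbrella statement FOR THE CANONICAL `B^temp`.

HONEST RESIDUAL: v1's (topology items, `hIIG hIIH hRG hRH`, the design data `hV hE hopen hBR noSwitchBase` ×2, the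
dictionary `dict θd hlo φc hφc hfaith hfull`, the represented graph actions `F θ hrep hpre/hpost`, `Cor39Hypotheses`
×2, `he`) with `btemp/hover/hbtempφ` ↦ `hZ/hcompat/hcont`.  Nothing beyond composition is proved here; typed ≠
proved for the inputs; Thm 5.4 (iii) for OUR tower decompositions; no side taken on [IUTchIII] Cor. 3.12.
-/

namespace Literature.AnabelianGeometry.SemiGraphs

open _root_.CategoryTheory _root_.Topology ProfiniteSemiGraph Literature.AnabelianGeometry.EtaleTheta

universe u v u₀

variable {Obj : Type u} [Category.{v} Obj] {𝓥 : SemiAnbdVocab.{u, v, u₀} Obj}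
variable {𝔊 ℍ : ArithSemiGraph 𝓥} {e : 𝔊.PA ≃* ℍ.PA}
variable {𝒢 ℋ : ProfiniteSemiGraph.{u₀}} {c𝒢 : TemperedPiChart 𝒢} {cℋ : TemperedPiChart ℋ}

/-- **[SemiAnbd] Thm 5.4 (iii), compatible reading, at the outer models, FOR THE CANONICAL `B^temp(φ)`**
(abc-iut-w4-d053's `outerSemidirectProductMap`): v1 with `btemp := outerSemidirectProductMap …`, `hover :=
outerSemidirectProductSnd_outerSemidirectProductMap`, `hbtempφ := outerSemidirectProductMap_toOuterSemidirectProduct`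
(`δ = 1`).  Residual: module docstring. [cite: MochizukiSemiAnbd2006, Thm 5.4 (iii), p. 66] -/
theorem arithQuasiGeometricCorrespondenceStatementCompat_outerModel_canonicalBTemp
    [Finite 𝒢.graph.Vertex] [Finite 𝒢.graph.Edge] [Finite ℋ.graph.Vertex] [Finite ℋ.graph.Edge]
    (h𝒢 : Cor39Hypotheses 𝒢) (hℋ : Cor39Hypotheses ℋ) (R𝒢 : ChartRepresentatives c𝒢) (Rℋ : ChartRepresentatives cℋ)
    -- the two outer models: outer actions over base actions, `ℍ′`'s over ITS OWN `Π_{A′}`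
    (ρ𝒢 : 𝔊.PA →* TopOut c𝒢.G) (baseAct𝒢 : 𝔊.PA →* Aut 𝒢.graph)
    (ρℋ : ℍ.PA →* TopOut cℋ.G) (baseActℋ : ℍ.PA →* Aut ℋ.graph)
    -- their topologies (abc-iut-w6-d070's `arithLevelTopology` package; pinned in v2)
    [TopologicalSpace (outerSemidirectProduct ρ𝒢)] [TopologicalSpace (outerSemidirectProduct ρℋ)]
    [IsTopologicalGroup (outerSemidirectProduct ρℋ)] [T2Space (outerSemidirectProduct ρℋ)]
    (hι𝒢c : Continuous (toOuterSemidirectProduct ρ𝒢)) (hιℋe : IsEmbedding (toOuterSemidirectProduct ρℋ))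
    (haugH : Continuous (outerSemidirectProductSnd ρℋ))
    -- Def 5.1 (i) DESIGN data of the two outer models (Prop 3.6 (iv) at `ρ(a)` incl. the branch-PAIR form,
    -- Def 5.1 (i)(c)) and Thm 5.4's printed frame «no switching of branches»
    (hV : ∀ (a : 𝔊.PA) (v : 𝒢.graph.Vertex) (H : Subgroup c𝒢.G), H ∈ verticialSubgroups c𝒢 v →
      ∃ φ : contMulAut c𝒢.G, TopOut.mk c𝒢.G φ = ρ𝒢 a ∧
        H.map (φ : MulAut c𝒢.G).toMonoidHom ∈ verticialSubgroups c𝒢 ((baseAct𝒢 a).hom.vertexMap v))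
    (hE : ∀ (a : 𝔊.PA) (x : 𝒢.graph.Edge) (K : Subgroup c𝒢.G), K ∈ edgeLikeSubgroups c𝒢 x →
      ∃ φ : contMulAut c𝒢.G, TopOut.mk c𝒢.G φ = ρ𝒢 a ∧
        K.map (φ : MulAut c𝒢.G).toMonoidHom ∈ edgeLikeSubgroups c𝒢 ((baseAct𝒢 a).hom.edgeMap x))
    (hopen : ∃ U : Subgroup 𝔊.PA, IsOpen (U : Set 𝔊.PA) ∧ ∀ a ∈ U,
      (∀ v, (baseAct𝒢 a).hom.vertexMap v = v) ∧ (∀ x, (baseAct𝒢 a).hom.edgeMap x = x) ∧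
        ∀ b, (baseAct𝒢 a).hom.branchMap b = b)
    (hBR : ∀ (a : 𝔊.PA) (b : 𝒢.graph.Branch) (v : 𝒢.graph.Vertex) (hb : 𝒢.graph.abuts b = some v)
      (φ : 𝒢.Gv v →ₜ* c𝒢.G), IsVerticialHom c𝒢 v φ →
      ∃ Φ : contMulAut c𝒢.G, TopOut.mk c𝒢.G Φ = ρ𝒢 a ∧
        ∃ φ' : 𝒢.Gv ((baseAct𝒢 a).hom.vertexMap v) →ₜ* c𝒢.G,
          IsVerticialHom c𝒢 ((baseAct𝒢 a).hom.vertexMap v) φ' ∧ ∃ x' : c𝒢.G,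
            Subgroup.map (Φ : MulAut c𝒢.G).toMonoidHom φ.toMonoidHom.range =
              Subgroup.map (MulAut.conj x').toMonoidHom φ'.toMonoidHom.range ∧
            Subgroup.map (Φ : MulAut c𝒢.G).toMonoidHom
                (Subgroup.map φ.toMonoidHom (𝒢.branchSubgroup b v hb)) =
              Subgroup.map (MulAut.conj x').toMonoidHom
                (Subgroup.map φ'.toMonoidHom
                  (𝒢.branchSubgroup ((baseAct𝒢 a).hom.branchMap b) ((baseAct𝒢 a).hom.vertexMap v)
                    ((baseAct𝒢 a).hom.abuts_branchMap b v hb))))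
    (noSwitchBase : NoBranchSwitching 𝒢.graph.edgeOf
      (fun (a : 𝔊.PA) (b : 𝒢.graph.Branch) => (baseAct𝒢 a).hom.branchMap b))
    (hV' : ∀ (a : ℍ.PA) (v : ℋ.graph.Vertex) (H : Subgroup cℋ.G), H ∈ verticialSubgroups cℋ v →
      ∃ φ : contMulAut cℋ.G, TopOut.mk cℋ.G φ = ρℋ a ∧
        H.map (φ : MulAut cℋ.G).toMonoidHom ∈ verticialSubgroups cℋ ((baseActℋ a).hom.vertexMap v))
    (hE' : ∀ (a : ℍ.PA) (x : ℋ.graph.Edge) (K : Subgroup cℋ.G), K ∈ edgeLikeSubgroups cℋ x →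
      ∃ φ : contMulAut cℋ.G, TopOut.mk cℋ.G φ = ρℋ a ∧
        K.map (φ : MulAut cℋ.G).toMonoidHom ∈ edgeLikeSubgroups cℋ ((baseActℋ a).hom.edgeMap x))
    (hopen' : ∃ U : Subgroup ℍ.PA, IsOpen (U : Set ℍ.PA) ∧ ∀ a ∈ U,
      (∀ v, (baseActℋ a).hom.vertexMap v = v) ∧ (∀ x, (baseActℋ a).hom.edgeMap x = x) ∧
        ∀ b, (baseActℋ a).hom.branchMap b = b)
    (hBR' : ∀ (a : ℍ.PA) (b : ℋ.graph.Branch) (v : ℋ.graph.Vertex) (hb : ℋ.graph.abuts b = some v)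
      (φ : ℋ.Gv v →ₜ* cℋ.G), IsVerticialHom cℋ v φ →
      ∃ Φ : contMulAut cℋ.G, TopOut.mk cℋ.G Φ = ρℋ a ∧
        ∃ φ' : ℋ.Gv ((baseActℋ a).hom.vertexMap v) →ₜ* cℋ.G,
          IsVerticialHom cℋ ((baseActℋ a).hom.vertexMap v) φ' ∧ ∃ x' : cℋ.G,
            Subgroup.map (Φ : MulAut cℋ.G).toMonoidHom φ.toMonoidHom.range =
              Subgroup.map (MulAut.conj x').toMonoidHom φ'.toMonoidHom.range ∧
            Subgroup.map (Φ : MulAut cℋ.G).toMonoidHom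
                (Subgroup.map φ.toMonoidHom (ℋ.branchSubgroup b v hb)) =
              Subgroup.map (MulAut.conj x').toMonoidHom
                (Subgroup.map φ'.toMonoidHom
                  (ℋ.branchSubgroup ((baseActℋ a).hom.branchMap b) ((baseActℋ a).hom.vertexMap v)
                    ((baseActℋ a).hom.abuts_branchMap b v hb))))
    (noSwitchBase' : NoBranchSwitching ℋ.graph.edgeOf
      (fun (a : ℍ.PA) (b : ℋ.graph.Branch) => (baseActℋ a).hom.branchMap b))
    -- Thm 5.4 (ii) and Rmk 5.3.1 at the two outer models, NATIVELY over `Π_A` resp. `Π_{A′}`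
    (hIIG : ArithMaximalCompactStatementII (decompositionDataOfChart R𝒢 (toOuterSemidirectProduct ρ𝒢))
      (outerSemidirectProductSnd ρ𝒢))
    (hIIH : ArithMaximalCompactStatementII (decompositionDataOfChart Rℋ (toOuterSemidirectProduct ρℋ))
      (outerSemidirectProductSnd ρℋ))
    (hRG : VerticialEdgeLikeCompactAmpleStatement (decompositionDataOfChart R𝒢 (toOuterSemidirectProduct ρ𝒢))
      (outerSemidirectProductSnd ρ𝒢))
    (hRH : VerticialEdgeLikeCompactAmpleStatement (decompositionDataOfChart Rℋ (toOuterSemidirectProduct ρℋ))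
      (outerSemidirectProductSnd ρℋ))
    -- (D1)/(D2): the dictionary of arrows with chosen 2-cells and its chart-level representatives (verbatim)
    (dict : (𝔊.G ⟶ ℍ.G) → Hom 𝒢 ℋ) (θd : ∀ g, (dict g).ConjugatorFamily) (hlo : ∀ g, (dict g).IsLocallyOpen)
    (φc : (𝔊.G ⟶ ℍ.G) → (c𝒢.G →ₜ* cℋ.G))
    (hφc : ∀ g, Nonempty ((dict g).chartPullbackWith (θd g) c𝒢 cℋ ≅ BTemp.res (φc g)))
    (hfaith : ∀ g₁ g₂ : 𝔊.G ⟶ ℍ.G, Nonempty ((dict g₁).chartPullbackWith (θd g₁) c𝒢 cℋ ≅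
      (dict g₂).chartPullbackWith (θd g₂) c𝒢 cℋ) → g₁ = g₂)
    (hfull : ∀ F : Hom 𝒢 ℋ, F.IsLocallyOpen → ∀ θ : F.ConjugatorFamily,
      ∃ g : 𝔊.G ⟶ ℍ.G, Nonempty ((dict g).chartPullbackWith (θd g) c𝒢 cℋ ≅ F.chartPullbackWith θ c𝒢 cℋ))
    -- (D1a)/(D1b): the graph actions of `Π_A` on `𝔾` and of `Π_{A′}` on `ℍ′` with chosen 2-cells, REPRESENTED at
    -- the outer actions (abc-iut-w5-d141's `hrep` currency), and the functoriality of the dictionary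
    (F𝒢 : 𝔊.PA → Hom 𝒢 𝒢) (θ𝒢 : ∀ a, (F𝒢 a).ConjugatorFamily)
    (hrep𝒢 : ∀ a, ∃ (Φ : contMulAut c𝒢.G) (φ : c𝒢.G →ₜ* c𝒢.G), TopOut.mk c𝒢.G Φ = ρ𝒢 a ∧
      (∀ t, (Φ : MulAut c𝒢.G) t = φ t) ∧ Nonempty ((F𝒢 a).chartPullbackWith (θ𝒢 a) c𝒢 c𝒢 ≅ BTemp.res φ))
    (hpre : ∀ (a : 𝔊.PA) (g : 𝔊.G ⟶ ℍ.G),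
      Nonempty ((dict ((𝔊.ρ a).hom ≫ g)).chartPullbackWith (θd ((𝔊.ρ a).hom ≫ g)) c𝒢 cℋ ≅
        (dict g).chartPullbackWith (θd g) c𝒢 cℋ ⋙ (F𝒢 a).chartPullbackWith (θ𝒢 a) c𝒢 c𝒢))
    (Fℋ : ℍ.PA → Hom ℋ ℋ) (θℋ : ∀ a, (Fℋ a).ConjugatorFamily)
    (hrepℋ : ∀ a, ∃ (Φ : contMulAut cℋ.G) (φ : cℋ.G →ₜ* cℋ.G), TopOut.mk cℋ.G Φ = ρℋ a ∧
      (∀ t, (Φ : MulAut cℋ.G) t = φ t) ∧ Nonempty ((Fℋ a).chartPullbackWith (θℋ a) cℋ cℋ ≅ BTemp.res φ))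
    (hpost : ∀ (a : ℍ.PA) (g : 𝔊.G ⟶ ℍ.G),
      Nonempty ((dict (g ≫ (ℍ.ρ a).hom)).chartPullbackWith (θd (g ≫ (ℍ.ρ a).hom)) c𝒢 cℋ ≅
        (Fℋ a).chartPullbackWith (θℋ a) cℋ cℋ ⋙ (dict g).chartPullbackWith (θd g) c𝒢 cℋ))
    -- `B^temp(φ)` CANONICAL (abc-iut-w4-d053's `outerSemidirectProductMap`, ArithBTempOuterModel.lean): its inputs —
    -- centraliser-free image of `φ̂_{φ_𝔾}` and compatibility of the representatives of `ρ_𝔾(a)`, `ρ_ℍ(e a)` along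
    -- `φ̂_{φ_𝔾}` — and its continuity for the chosen topologies (the one law not treated there)
    (hZ : ∀ (φ : ArithHom 𝓥 𝔊 ℍ), φ.IsLocallyOpen → ArithHom.IsOverA 𝔊 ℍ e φ →
      ∀ h : cℋ.G, (∀ y : c𝒢.G, h * (φc φ.geom).toMonoidHom y * h⁻¹ = (φc φ.geom).toMonoidHom y) → h = 1)
    (hcompat : ∀ (φ : ArithHom 𝓥 𝔊 ℍ), φ.IsLocallyOpen → ArithHom.IsOverA 𝔊 ℍ e φ →
      ∀ p : outerSemidirectProduct ρ𝒢, ∃ β' : contMulAut cℋ.G,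
        TopOut.mk cℋ.G β' = ρℋ (e.toMonoidHom (outerSemidirectProductSnd ρ𝒢 p)) ∧
          ∀ y, (β' : MulAut cℋ.G) ((φc φ.geom).toMonoidHom y) = (φc φ.geom).toMonoidHom ((p.1.1 : MulAut c𝒢.G) y))
    (hcont : ∀ (φ : ArithHom 𝓥 𝔊 ℍ) (h₁ : φ.IsLocallyOpen) (h₂ : ArithHom.IsOverA 𝔊 ℍ e φ),
      Continuous (outerSemidirectProductMap ρ𝒢 ρℋ e.toMonoidHom (φc φ.geom).toMonoidHom (hcompat φ h₁ h₂) (hZ φ h₁ h₂)))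
    (he : Continuous e) :
    Literature.AnabelianGeometry.SemiGraphs.ArithQuasiGeometricCorrespondenceStatementCompat 𝔊 ℍ e
      (outerSemidirectProductSnd ρ𝒢) (outerSemidirectProductSnd ρℋ)
      (fun φ h₁ h₂ => outerSemidirectProductMap ρ𝒢 ρℋ e.toMonoidHom (φc φ.geom).toMonoidHom (hcompat φ h₁ h₂) (hZ φ h₁ h₂)) :=
  arithQuasiGeometricCorrespondenceStatementCompat_outerModel h𝒢 hℋ R𝒢 Rℋ ρ𝒢 baseAct𝒢 ρℋ baseActℋ hι𝒢c hιℋe haugH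
    (fun φ h₁ h₂ => outerSemidirectProductMap ρ𝒢 ρℋ e.toMonoidHom (φc φ.geom).toMonoidHom (hcompat φ h₁ h₂) (hZ φ h₁ h₂))
    hcont
    (fun φ h₁ h₂ => by
      ext p
      simp only [MonoidHom.coe_comp, Function.comp_apply, MulEquiv.coe_toMonoidHom,
        outerSemidirectProductSnd_outerSemidirectProductMap, MulEquiv.symm_apply_apply])
    hV hE hopen hBR noSwitchBase hV' hE' hopen' hBR' noSwitchBase' hIIG hIIH hRG hRH dict θd hlo φc hφc hfaith hfull
    F𝒢 θ𝒢 hrep𝒢 hpre Fℋ θℋ hrepℋ hpost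
    (fun φ h₁ h₂ => ⟨1, Subgroup.one_mem _, fun y => by
      rw [outerSemidirectProductMap_toOuterSemidirectProduct, one_mul, inv_one, mul_one]; rfl⟩)
    he


/-- **[SemiAnbd] Thm 5.4 (iii) at the outer models for the canonical `B^temp(φ)`, its centraliser-freeness input
DISCHARGED** by abc-iut-w4-d053's `centraliserFree_of_chartPullbackWith_iso` (ArithBTempCentraliserFree.lean, p440786:
a homomorphism `φ̂` realising the chart pull-back of a LOCALLY OPEN morphism of semi-graphs of anabelioids has
centraliser-free image — Thm 3.7 (i)/(ii) + verticial slimness): `btemp φ := outerSemidirectProductMap ρ_𝔾 ρ_ℍ e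
φ̂_{φ_𝔾} (hcompat φ …) (that theorem at the dictionary arrow dict φ_𝔾)`.  Residual w.r.t. v2: `hZ` GONE — the canonical
`B^temp` now costs only the equivariance datum `hcompat` (and its continuity `hcont`).
[cite: MochizukiSemiAnbd2006, Thm 5.4 (iii), p. 66] -/
theorem arithQuasiGeometricCorrespondenceStatementCompat_outerModel_canonicalBTemp_of_dict
    [Finite 𝒢.graph.Vertex] [Finite 𝒢.graph.Edge] [Finite ℋ.graph.Vertex] [Finite ℋ.graph.Edge]
    (h𝒢 : Cor39Hypotheses 𝒢) (hℋ : Cor39Hypotheses ℋ) (R𝒢 : ChartRepresentatives c𝒢) (Rℋ : ChartRepresentatives cℋ)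
    -- the two outer models: outer actions over base actions, `ℍ′`'s over ITS OWN `Π_{A′}`
    (ρ𝒢 : 𝔊.PA →* TopOut c𝒢.G) (baseAct𝒢 : 𝔊.PA →* Aut 𝒢.graph)
    (ρℋ : ℍ.PA →* TopOut cℋ.G) (baseActℋ : ℍ.PA →* Aut ℋ.graph)
    -- their topologies (abc-iut-w6-d070's `arithLevelTopology` package; pinned in v2)
    [TopologicalSpace (outerSemidirectProduct ρ𝒢)] [TopologicalSpace (outerSemidirectProduct ρℋ)]
    [IsTopologicalGroup (outerSemidirectProduct ρℋ)] [T2Space (outerSemidirectProduct ρℋ)]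
    (hι𝒢c : Continuous (toOuterSemidirectProduct ρ𝒢)) (hιℋe : IsEmbedding (toOuterSemidirectProduct ρℋ))
    (haugH : Continuous (outerSemidirectProductSnd ρℋ))
    -- Def 5.1 (i) DESIGN data of the two outer models (Prop 3.6 (iv) at `ρ(a)` incl. the branch-PAIR form,
    -- Def 5.1 (i)(c)) and Thm 5.4's printed frame «no switching of branches»
    (hV : ∀ (a : 𝔊.PA) (v : 𝒢.graph.Vertex) (H : Subgroup c𝒢.G), H ∈ verticialSubgroups c𝒢 v →
      ∃ φ : contMulAut c𝒢.G, TopOut.mk c𝒢.G φ = ρ𝒢 a ∧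
        H.map (φ : MulAut c𝒢.G).toMonoidHom ∈ verticialSubgroups c𝒢 ((baseAct𝒢 a).hom.vertexMap v))
    (hE : ∀ (a : 𝔊.PA) (x : 𝒢.graph.Edge) (K : Subgroup c𝒢.G), K ∈ edgeLikeSubgroups c𝒢 x →
      ∃ φ : contMulAut c𝒢.G, TopOut.mk c𝒢.G φ = ρ𝒢 a ∧
        K.map (φ : MulAut c𝒢.G).toMonoidHom ∈ edgeLikeSubgroups c𝒢 ((baseAct𝒢 a).hom.edgeMap x))
    (hopen : ∃ U : Subgroup 𝔊.PA, IsOpen (U : Set 𝔊.PA) ∧ ∀ a ∈ U,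
      (∀ v, (baseAct𝒢 a).hom.vertexMap v = v) ∧ (∀ x, (baseAct𝒢 a).hom.edgeMap x = x) ∧
        ∀ b, (baseAct𝒢 a).hom.branchMap b = b)
    (hBR : ∀ (a : 𝔊.PA) (b : 𝒢.graph.Branch) (v : 𝒢.graph.Vertex) (hb : 𝒢.graph.abuts b = some v)
      (φ : 𝒢.Gv v →ₜ* c𝒢.G), IsVerticialHom c𝒢 v φ →
      ∃ Φ : contMulAut c𝒢.G, TopOut.mk c𝒢.G Φ = ρ𝒢 a ∧
        ∃ φ' : 𝒢.Gv ((baseAct𝒢 a).hom.vertexMap v) →ₜ* c𝒢.G,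
          IsVerticialHom c𝒢 ((baseAct𝒢 a).hom.vertexMap v) φ' ∧ ∃ x' : c𝒢.G,
            Subgroup.map (Φ : MulAut c𝒢.G).toMonoidHom φ.toMonoidHom.range =
              Subgroup.map (MulAut.conj x').toMonoidHom φ'.toMonoidHom.range ∧
            Subgroup.map (Φ : MulAut c𝒢.G).toMonoidHom
                (Subgroup.map φ.toMonoidHom (𝒢.branchSubgroup b v hb)) =
              Subgroup.map (MulAut.conj x').toMonoidHom
                (Subgroup.map φ'.toMonoidHom
                  (𝒢.branchSubgroup ((baseAct𝒢 a).hom.branchMap b) ((baseAct𝒢 a).hom.vertexMap v)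
                    ((baseAct𝒢 a).hom.abuts_branchMap b v hb))))
    (noSwitchBase : NoBranchSwitching 𝒢.graph.edgeOf
      (fun (a : 𝔊.PA) (b : 𝒢.graph.Branch) => (baseAct𝒢 a).hom.branchMap b))
    (hV' : ∀ (a : ℍ.PA) (v : ℋ.graph.Vertex) (H : Subgroup cℋ.G), H ∈ verticialSubgroups cℋ v →
      ∃ φ : contMulAut cℋ.G, TopOut.mk cℋ.G φ = ρℋ a ∧
        H.map (φ : MulAut cℋ.G).toMonoidHom ∈ verticialSubgroups cℋ ((baseActℋ a).hom.vertexMap v))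
    (hE' : ∀ (a : ℍ.PA) (x : ℋ.graph.Edge) (K : Subgroup cℋ.G), K ∈ edgeLikeSubgroups cℋ x →
      ∃ φ : contMulAut cℋ.G, TopOut.mk cℋ.G φ = ρℋ a ∧
        K.map (φ : MulAut cℋ.G).toMonoidHom ∈ edgeLikeSubgroups cℋ ((baseActℋ a).hom.edgeMap x))
    (hopen' : ∃ U : Subgroup ℍ.PA, IsOpen (U : Set ℍ.PA) ∧ ∀ a ∈ U,
      (∀ v, (baseActℋ a).hom.vertexMap v = v) ∧ (∀ x, (baseActℋ a).hom.edgeMap x = x) ∧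
        ∀ b, (baseActℋ a).hom.branchMap b = b)
    (hBR' : ∀ (a : ℍ.PA) (b : ℋ.graph.Branch) (v : ℋ.graph.Vertex) (hb : ℋ.graph.abuts b = some v)
      (φ : ℋ.Gv v →ₜ* cℋ.G), IsVerticialHom cℋ v φ →
      ∃ Φ : contMulAut cℋ.G, TopOut.mk cℋ.G Φ = ρℋ a ∧
        ∃ φ' : ℋ.Gv ((baseActℋ a).hom.vertexMap v) →ₜ* cℋ.G,
          IsVerticialHom cℋ ((baseActℋ a).hom.vertexMap v) φ' ∧ ∃ x' : cℋ.G,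
            Subgroup.map (Φ : MulAut cℋ.G).toMonoidHom φ.toMonoidHom.range =
              Subgroup.map (MulAut.conj x').toMonoidHom φ'.toMonoidHom.range ∧
            Subgroup.map (Φ : MulAut cℋ.G).toMonoidHom
                (Subgroup.map φ.toMonoidHom (ℋ.branchSubgroup b v hb)) =
              Subgroup.map (MulAut.conj x').toMonoidHom
                (Subgroup.map φ'.toMonoidHom
                  (ℋ.branchSubgroup ((baseActℋ a).hom.branchMap b) ((baseActℋ a).hom.vertexMap v)
                    ((baseActℋ a).hom.abuts_branchMap b v hb))))
    (noSwitchBase' : NoBranchSwitching ℋ.graph.edgeOf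
      (fun (a : ℍ.PA) (b : ℋ.graph.Branch) => (baseActℋ a).hom.branchMap b))
    -- Thm 5.4 (ii) and Rmk 5.3.1 at the two outer models, NATIVELY over `Π_A` resp. `Π_{A′}`
    (hIIG : ArithMaximalCompactStatementII (decompositionDataOfChart R𝒢 (toOuterSemidirectProduct ρ𝒢))
      (outerSemidirectProductSnd ρ𝒢))
    (hIIH : ArithMaximalCompactStatementII (decompositionDataOfChart Rℋ (toOuterSemidirectProduct ρℋ))
      (outerSemidirectProductSnd ρℋ))
    (hRG : VerticialEdgeLikeCompactAmpleStatement (decompositionDataOfChart R𝒢 (toOuterSemidirectProduct ρ𝒢))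
      (outerSemidirectProductSnd ρ𝒢))
    (hRH : VerticialEdgeLikeCompactAmpleStatement (decompositionDataOfChart Rℋ (toOuterSemidirectProduct ρℋ))
      (outerSemidirectProductSnd ρℋ))
    -- (D1)/(D2): the dictionary of arrows with chosen 2-cells and its chart-level representatives (verbatim)
    (dict : (𝔊.G ⟶ ℍ.G) → Hom 𝒢 ℋ) (θd : ∀ g, (dict g).ConjugatorFamily) (hlo : ∀ g, (dict g).IsLocallyOpen)
    (φc : (𝔊.G ⟶ ℍ.G) → (c𝒢.G →ₜ* cℋ.G))
    (hφc : ∀ g, Nonempty ((dict g).chartPullbackWith (θd g) c𝒢 cℋ ≅ BTemp.res (φc g)))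
    (hfaith : ∀ g₁ g₂ : 𝔊.G ⟶ ℍ.G, Nonempty ((dict g₁).chartPullbackWith (θd g₁) c𝒢 cℋ ≅
      (dict g₂).chartPullbackWith (θd g₂) c𝒢 cℋ) → g₁ = g₂)
    (hfull : ∀ F : Hom 𝒢 ℋ, F.IsLocallyOpen → ∀ θ : F.ConjugatorFamily,
      ∃ g : 𝔊.G ⟶ ℍ.G, Nonempty ((dict g).chartPullbackWith (θd g) c𝒢 cℋ ≅ F.chartPullbackWith θ c𝒢 cℋ))
    -- (D1a)/(D1b): the graph actions of `Π_A` on `𝔾` and of `Π_{A′}` on `ℍ′` with chosen 2-cells, REPRESENTED at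
    -- the outer actions (abc-iut-w5-d141's `hrep` currency), and the functoriality of the dictionary
    (F𝒢 : 𝔊.PA → Hom 𝒢 𝒢) (θ𝒢 : ∀ a, (F𝒢 a).ConjugatorFamily)
    (hrep𝒢 : ∀ a, ∃ (Φ : contMulAut c𝒢.G) (φ : c𝒢.G →ₜ* c𝒢.G), TopOut.mk c𝒢.G Φ = ρ𝒢 a ∧
      (∀ t, (Φ : MulAut c𝒢.G) t = φ t) ∧ Nonempty ((F𝒢 a).chartPullbackWith (θ𝒢 a) c𝒢 c𝒢 ≅ BTemp.res φ))
    (hpre : ∀ (a : 𝔊.PA) (g : 𝔊.G ⟶ ℍ.G),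
      Nonempty ((dict ((𝔊.ρ a).hom ≫ g)).chartPullbackWith (θd ((𝔊.ρ a).hom ≫ g)) c𝒢 cℋ ≅
        (dict g).chartPullbackWith (θd g) c𝒢 cℋ ⋙ (F𝒢 a).chartPullbackWith (θ𝒢 a) c𝒢 c𝒢))
    (Fℋ : ℍ.PA → Hom ℋ ℋ) (θℋ : ∀ a, (Fℋ a).ConjugatorFamily)
    (hrepℋ : ∀ a, ∃ (Φ : contMulAut cℋ.G) (φ : cℋ.G →ₜ* cℋ.G), TopOut.mk cℋ.G Φ = ρℋ a ∧
      (∀ t, (Φ : MulAut cℋ.G) t = φ t) ∧ Nonempty ((Fℋ a).chartPullbackWith (θℋ a) cℋ cℋ ≅ BTemp.res φ))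
    (hpost : ∀ (a : ℍ.PA) (g : 𝔊.G ⟶ ℍ.G),
      Nonempty ((dict (g ≫ (ℍ.ρ a).hom)).chartPullbackWith (θd (g ≫ (ℍ.ρ a).hom)) c𝒢 cℋ ≅
        (Fℋ a).chartPullbackWith (θℋ a) cℋ cℋ ⋙ (dict g).chartPullbackWith (θd g) c𝒢 cℋ))
    -- `B^temp(φ)` CANONICAL (abc-iut-w4-d053's `outerSemidirectProductMap`): its ONE remaining input — compatibility of
    -- the representatives of `ρ_𝔾(a)`, `ρ_ℍ(e a)` along `φ̂_{φ_𝔾}` (the centraliser-freeness `hZ` being abc-iut-w4-d053's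
    -- THEOREM `centraliserFree_of_chartPullbackWith_iso` for the locally open dictionary arrow) — and its continuity
    (hcompat : ∀ (φ : ArithHom 𝓥 𝔊 ℍ), φ.IsLocallyOpen → ArithHom.IsOverA 𝔊 ℍ e φ →
      ∀ p : outerSemidirectProduct ρ𝒢, ∃ β' : contMulAut cℋ.G,
        TopOut.mk cℋ.G β' = ρℋ (e.toMonoidHom (outerSemidirectProductSnd ρ𝒢 p)) ∧
          ∀ y, (β' : MulAut cℋ.G) ((φc φ.geom).toMonoidHom y) = (φc φ.geom).toMonoidHom ((p.1.1 : MulAut c𝒢.G) y))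
    (hcont : ∀ (φ : ArithHom 𝓥 𝔊 ℍ) (h₁ : φ.IsLocallyOpen) (h₂ : ArithHom.IsOverA 𝔊 ℍ e φ),
      Continuous (outerSemidirectProductMap ρ𝒢 ρℋ e.toMonoidHom (φc φ.geom).toMonoidHom (hcompat φ h₁ h₂) (centraliserFree_of_chartPullbackWith_iso h𝒢.thm37Hypotheses hℋ.thm37Hypotheses c𝒢 cℋ (dict φ.geom) (θd φ.geom) (hlo φ.geom) (φc φ.geom) (hφc φ.geom))))
    (he : Continuous e) :
    Literature.AnabelianGeometry.SemiGraphs.ArithQuasiGeometricCorrespondenceStatementCompat 𝔊 ℍ e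
      (outerSemidirectProductSnd ρ𝒢) (outerSemidirectProductSnd ρℋ)
      (fun φ h₁ h₂ => outerSemidirectProductMap ρ𝒢 ρℋ e.toMonoidHom (φc φ.geom).toMonoidHom (hcompat φ h₁ h₂) (centraliserFree_of_chartPullbackWith_iso h𝒢.thm37Hypotheses hℋ.thm37Hypotheses c𝒢 cℋ (dict φ.geom) (θd φ.geom) (hlo φ.geom) (φc φ.geom) (hφc φ.geom))) :=
  arithQuasiGeometricCorrespondenceStatementCompat_outerModel_canonicalBTemp h𝒢 hℋ R𝒢 Rℋ ρ𝒢 baseAct𝒢 ρℋ baseActℋ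
    hι𝒢c hιℋe haugH hV hE hopen hBR noSwitchBase hV' hE' hopen' hBR' noSwitchBase' hIIG hIIH hRG hRH dict θd hlo φc hφc
    hfaith hfull F𝒢 θ𝒢 hrep𝒢 hpre Fℋ θℋ hrepℋ hpost
    (fun φ _ _ => centraliserFree_of_chartPullbackWith_iso h𝒢.thm37Hypotheses hℋ.thm37Hypotheses c𝒢 cℋ (dict φ.geom)
      (θd φ.geom) (hlo φ.geom) (φc φ.geom) (hφc φ.geom))
    hcompat hcont he

end Literature.AnabelianGeometry.SemiGraphs
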